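import Summits.BirchSwinnertonDyer.BirchSwinnertonDyer.Theorems.PrintX11aUpperNonSurjFiveMuAnOfOrbitUnit
import Literature.NumberTheory.EllipticCurves.PAdicLFunctionRiemannSumCongruenceCertificateProofs
import HarnessLib

/-!
# Crux U5 `PrintX11a.UpperNonSurjFive` (item stmt-BirchSwinnertonDyer-20614), line finemu5 ⊕ multteich5 —
# DICTIONARY COMPLETENESS: a unit coefficient of `L_p(E,T)` gives back a unit Teichmüller orbit sum (converse of S3)

Seat `bsd-line-x11a-p3` g2 (LEAD of crux 20614), `--supports stmt-BirchSwinnertonDyer-20614 --as helper`.  Theorems only (no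
definition, no named fact, no `sorry`); Theses-free.

With S3 (`stub_multMuAn_of_orbitUnit`, p613261: unit orbit sum ⟹ unit coefficient of `ϖ·L`) this file closes the circle at
the pair: for `E = W/ℚ` with multiplicative reduction at an odd `p` and `E[p]` irreducible, and THE Mazur–Tate–Teitelbaum
function `L` of the newform `f` with the allowable root `a = ±1`, a coefficient of `L` of norm `≥ 1` forces a Teichmüller orbit
sum `A_n(u)` (`n ≥ 1`, `u` a unit) of norm `≥ 1` (`exists_one_le_norm_teichOrbitSum_of_one_le_norm_coeff`).  So on the U5 domain the
orbit-unit carrier `MultTeichOrbitUnitAt` of the skeleton's fallback composition `UpperNonSurjFive_of_orbitUnit` is not a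
strengthening of the μ-claim but the SAME statement read on modular symbols: the registered open stub S1 (`MultTeichSpanGen`) is the
only content of the μ-road beyond Greenberg's `μ(ω⁰) = 0` itself.

Proof (Mazur–Tate–Teitelbaum §I.12–I.13 in the tree's kernel form): the symbols `[a/pᵐ]⁺_f` are `p`-integral (irreducibility +
`IsNewformOf.norm_ratPlusSymbol_val_div_le_max_of_multiplicative`); the tree's congruence certificate
`Is[Split]MultPAdicLFunctionOf.norm_coeff_sub_riemannSum_le_mul_inv_of_{nonsplit,split}` gives `‖[T^k]L − RS_k,n‖ ≤ p⁻¹` for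
`k < pⁿ`, where the Riemann sum `RS_k,n = Σ_s binom(s,k)·ν(s)` is a `ℤ_p`-combination of the Teichmüller COSET MASSES
`ν(s) = ±Σ_ξ [ξγ^s/p^{n+e₀}]⁺ = ±A_{n+e₀}(γ^s)` (`finsum_class_eq_sum_filter_mul`: the tree's `MuCoset.finsum_coset_eq_sum_filter` +
the unit reindexing `sum_filter_pow_eq_one_mul_eq` of the S3 file); if every orbit sum at level `n + e₀` had norm `< 1`, then
`‖RS_k,n‖ < 1` and `‖[T^k]L‖ < 1`.
HONEST FRAMING: per-pair bookkeeping; nothing about any curve is asserted unconditionally; the crux stays open.  beyond-print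
theorem: no.  BSD is not proved by any of this.
References: [MazurTateTeitelbaum1986Invent] §I.10 (10.1), §I.12–I.13; [SteinWuthrich2013] §3; [Washington1997] §5.1, §7.2.
-/

-- the summit namespace repeats `BirchSwinnertonDyer` by design (summit = problem); linter moot
set_option linter.dupNamespace false
set_option autoImplicit false

noncomputable section

open scoped Classical MatrixGroups ModularForm
open CongruenceSubgroup
open Literature.NumberTheory.EllipticCurves.Rank1Residual

namespace Summit.BirchSwinnertonDyer.BirchSwinnertonDyer.Cruxes.UpperNonSurjFive.MultTeich

open WeierstrassCurve
  Literature.NumberTheory.EllipticCurves Literature.NumberTheory.EllipticCurves.ModularForms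
  Summit.BirchSwinnertonDyer.Rank1Residual
  Summit.BirchSwinnertonDyer.BirchSwinnertonDyer.Theorems.CollapseThree
  Summit.BirchSwinnertonDyer.BirchSwinnertonDyer.Cruxes.AnalyticMuZeroX9.TeichSpan

/-! ### §A The Teichmüller class sum at `γ^s` is the orbit sum `A_{n+e₀}(γ^s)` -/

section ClassSum

variable {p : ℕ} [Fact p.Prime]

/-- **The `∑ᶠ ξ`-class sum is an orbit sum**: for odd `p`, `Σ_ξ g(ξ·γ^s) = Σ_{η^{p−1}=1} g(η·γ^s)` at level `n + e₀`
(`MuCoset.finsum_coset_eq_sum_filter` followed by the unit reindexing `sum_filter_pow_eq_one_mul_eq` with `u = γ^s`).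
[cite: Washington1997, §5.1 and §7.2] [cite: MazurTateTeitelbaum1986Invent, §I.13] -/
theorem finsum_class_eq_sum_filter_mul (hp2 : p ≠ 2) (n : ℕ) (s : ZMod (p ^ n)) {M : Type*} [AddCommMonoid M]
    (g : ZMod (p ^ (n + cyclotomicExponent p)) → M) :
    ∑ᶠ ξ : rootsOfUnity (torsionOrder p) ℤ_[p],
        g (PadicInt.toZModPow (n + cyclotomicExponent p) ((ξ : ℤ_[p]ˣ) : ℤ_[p]) *
          (cyclotomicGenerator p : ZMod (p ^ (n + cyclotomicExponent p))) ^ s.val) =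
      ∑ t ∈ Finset.univ.filter (fun t : ZMod (p ^ (n + cyclotomicExponent p)) ↦ t ^ (p - 1) = 1),
        g (t * ((((isUnit_cyclotomicGenerator_cast p (n + cyclotomicExponent p)).pow s.val).unit :
          (ZMod (p ^ (n + cyclotomicExponent p)))ˣ) : ZMod (p ^ (n + cyclotomicExponent p)))) := by
  classical
  have hτ : torsionOrder p = p - 1 := by rw [torsionOrder_eq, if_neg hp2]
  set u : (ZMod (p ^ (n + cyclotomicExponent p)))ˣ :=
    ((isUnit_cyclotomicGenerator_cast p (n + cyclotomicExponent p)).pow s.val).unit with hu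
  have huval : (u : ZMod (p ^ (n + cyclotomicExponent p))) =
      (cyclotomicGenerator p : ZMod (p ^ (n + cyclotomicExponent p))) ^ s.val := IsUnit.unit_spec _
  rw [X11a.MuCoset.finsum_coset_eq_sum_filter p hp2 n s g, hτ, sum_filter_pow_eq_one_mul_eq u g, huval, ← pow_mul,
    mul_comm]

end ClassSum

/-! ### §B The converse of S3 at the pair: a unit coefficient gives a unit orbit sum -/

section Converse

variable {W : WeierstrassCurve ℚ} [W.IsElliptic] [W.IsGloballyMinimal] {p : ℕ} [Fact p.Prime]
  {N : ℕ} [NeZero N] {f : CuspForm (Gamma0 N) 2}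

/-- **Converse of S3 (dictionary completeness at the pair).**  `E = W/ℚ` with multiplicative reduction at an ODD prime `p`,
`E[p]` irreducible, `f` a newform of `E`, `L` a Mazur–Tate–Teitelbaum function of `f` at `p` with the allowable root `a`
(`a = 1` split, `a = −1` non-split).  If some coefficient of `L` has norm `≥ 1`, then some Teichmüller orbit sum `A_n(u)` with
`n ≥ 1` and `u` a unit has norm `≥ 1`.  (With `‖ϖ‖_p = 1` — Mazur — the hypothesis is the same for `ϖ·L`.)  Proof in the module
docstring. [cite: MazurTateTeitelbaum1986Invent, §I.10 (10.1), §I.12–I.13] [cite: SteinWuthrich2013, §3] -/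
theorem exists_one_le_norm_teichOrbitSum_of_one_le_norm_coeff (hp2 : p ≠ 2)
    (hmult : W.HasMultiplicativeReductionAtPrime p) (hirr : W.HasIrreducibleModPGaloisRep p) (hf : IsNewformOf W f)
    {a : ℚ_[p]} {L : PowerSeries ℚ_[p]}
    (hsa : W.HasSplitMultiplicativeReductionAtPrime p → a = 1)
    (hna : ¬ W.HasSplitMultiplicativeReductionAtPrime p → a = -1)
    (hL : IsMultPAdicLFunctionOf f p a L) {k : ℕ} (hk : 1 ≤ ‖PowerSeries.coeff k L‖) :
    ∃ n : ℕ, 1 ≤ n ∧ ∃ u : (ZMod (p ^ n))ˣ, 1 ≤ ‖((teichOrbitSum f p n (u : ZMod (p ^ n)) : ℚ) : ℚ_[p])‖ := by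
  classical
  have hp : p.Prime := Fact.out
  haveI := neZero_torsionOrder p
  haveI := Fintype.ofFinite (rootsOfUnity (torsionOrder p) ℤ_[p])
  have he : cyclotomicExponent p = 1 := if_neg hp2
  -- integrality of the symbol table (irreducibility)
  obtain ⟨n₀, hpn₀, h0Λ⟩ :=
    exists_intCast_mul_modularSymbol_zero_mem not_irreducible_of_frobeniusTrace_congr_holds hf hirr
  have h00 : ‖((ratPlusSymbol f 0 : ℚ) : ℚ_[p])‖ ≤ 1 :=
    norm_ratPlusSymbol_le_one f hp2 hpn₀ h0Λ (by rw [Rat.den_zero]; exact Nat.coprime_one_left N)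
  have hintZ : ∀ (m : ℕ) (b : ZMod (p ^ m)),
      ‖((ratPlusSymbol f ((b.val : ℚ) / (p : ℚ) ^ m) : ℚ) : ℚ_[p])‖ ≤ 1 := fun m b ↦
    (hf.norm_ratPlusSymbol_val_div_le_max_of_multiplicative hp2 hmult m b).trans (max_le le_rfl h00)
  -- a level `n` with `k < pⁿ`
  obtain ⟨n, hkn⟩ : ∃ n : ℕ, k < p ^ n := ⟨k, Nat.lt_pow_self hp.one_lt⟩
  -- suppose every orbit sum at level `n + e₀` over a unit has norm `< 1`
  by_contra H
  push Not at H
  have Hn : ∀ u : (ZMod (p ^ (n + cyclotomicExponent p)))ˣ,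
      ‖((teichOrbitSum f p (n + cyclotomicExponent p) (u : ZMod (p ^ (n + cyclotomicExponent p))) : ℚ) :
        ℚ_[p])‖ < 1 := fun u ↦ H (n + cyclotomicExponent p) (by rw [he]; omega) u
  -- the signed/unsigned table and its Riemann sums
  have key : ∀ (σ : ℚ_[p]), ‖σ‖ ≤ 1 →
      ‖∑ᶠ ξ : rootsOfUnity (torsionOrder p) ℤ_[p], ∑ s : ZMod (p ^ n),
        (fun (m : ℕ) (b : ZMod (p ^ m)) ↦ σ ^ m * ((ratPlusSymbol f ((b.val : ℚ) / (p : ℚ) ^ m) : ℚ) : ℚ_[p]))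
          (n + cyclotomicExponent p)
            (PadicInt.toZModPow (n + cyclotomicExponent p) ((ξ : ℤ_[p]ˣ) : ℤ_[p]) *
              (cyclotomicGenerator p : ZMod (p ^ (n + cyclotomicExponent p))) ^ s.val) *
          ((s.val.choose k : ℕ) : ℚ_[p])‖ < 1 := by
    intro σ hσ
    rw [finsum_eq_sum_of_fintype, Finset.sum_comm]
    refine norm_sum_lt_one _ _ fun s _ ↦ ?_
    rw [← Finset.sum_mul, norm_mul]
    set u : (ZMod (p ^ (n + cyclotomicExponent p)))ˣ :=
      ((isUnit_cyclotomicGenerator_cast p (n + cyclotomicExponent p)).pow s.val).unit with hu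
    have hswap : (∑ ξ : rootsOfUnity (torsionOrder p) ℤ_[p],
        (fun (m : ℕ) (b : ZMod (p ^ m)) ↦ σ ^ m * ((ratPlusSymbol f ((b.val : ℚ) / (p : ℚ) ^ m) : ℚ) : ℚ_[p]))
          (n + cyclotomicExponent p)
            (PadicInt.toZModPow (n + cyclotomicExponent p) ((ξ : ℤ_[p]ˣ) : ℤ_[p]) *
              (cyclotomicGenerator p : ZMod (p ^ (n + cyclotomicExponent p))) ^ s.val)) =
        σ ^ (n + cyclotomicExponent p) *
          ((teichOrbitSum f p (n + cyclotomicExponent p) (u : ZMod (p ^ (n + cyclotomicExponent p))) : ℚ) :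
            ℚ_[p]) := by
      rw [← finsum_eq_sum_of_fintype]
      beta_reduce
      rw [finsum_class_eq_sum_filter_mul hp2 n s (fun b ↦ σ ^ (n + cyclotomicExponent p) *
        ((ratPlusSymbol f ((b.val : ℚ) / (p : ℚ) ^ (n + cyclotomicExponent p)) : ℚ) : ℚ_[p])),
        ← Finset.mul_sum, teichOrbitSum_def, Rat.cast_sum]
    rw [hswap, norm_mul, norm_pow]
    have hA := Hn u
    have hbin : ‖((s.val.choose k : ℕ) : ℚ_[p])‖ ≤ 1 := by
      exact_mod_cast Padic.norm_int_le_one (p := p) (s.val.choose k : ℤ)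
    have hσn : ‖σ‖ ^ (n + cyclotomicExponent p) ≤ 1 := pow_le_one₀ (norm_nonneg _) hσ
    calc ‖σ‖ ^ (n + cyclotomicExponent p) *
          ‖((teichOrbitSum f p (n + cyclotomicExponent p) (u : ZMod (p ^ (n + cyclotomicExponent p))) : ℚ) :
            ℚ_[p])‖ * ‖((s.val.choose k : ℕ) : ℚ_[p])‖
        ≤ 1 * ‖((teichOrbitSum f p (n + cyclotomicExponent p) (u : ZMod (p ^ (n + cyclotomicExponent p))) : ℚ) :
            ℚ_[p])‖ * 1 := by
          gcongr
      _ < 1 := by rw [one_mul, mul_one]; exact hA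
  -- the congruence certificate: `‖[T^k]L − RS_k,n‖ ≤ p⁻¹ < 1`, contradiction with `‖[T^k]L‖ ≥ 1`
  have hp1 : (1 : ℝ) * (p : ℝ)⁻¹ < 1 := by
    rw [one_mul]; exact inv_lt_one_of_one_lt₀ (by exact_mod_cast hp.one_lt)
  by_cases hs : W.HasSplitMultiplicativeReductionAtPrime p
  · have ha : a = 1 := hsa hs
    subst ha
    have hL' : IsSplitMultPAdicLFunctionOf f p L := (isMultPAdicLFunctionOf_one_iff L).mp hL
    have hcert := hL'.norm_coeff_sub_riemannSum_le_mul_inv_of_split (fun _ _ ↦ rfl) hs hf (C := 1) hintZ hkn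
    have hRS := key 1 (by rw [norm_one])
    simp only [one_pow, one_mul] at hRS
    have hlt : ‖PowerSeries.coeff k L‖ < 1 := by
      have h := (hcert.trans_lt hp1)
      calc ‖PowerSeries.coeff k L‖ = ‖(PowerSeries.coeff k L - _) + _‖ := by rw [sub_add_cancel]
        _ ≤ max ‖PowerSeries.coeff k L - _‖ ‖_‖ := Padic.nonarchimedean _ _
        _ < 1 := max_lt h hRS
    exact absurd hk (not_le.mpr hlt)
  · have ha : a = -1 := hna hs
    subst ha
    have hcert := hL.norm_coeff_sub_riemannSum_le_mul_inv_of_nonsplit (fun _ _ ↦ rfl) hf hmult hs (C := 1) hintZ hkn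
    have hRS := key (-1) (by rw [norm_neg, norm_one])
    have hlt : ‖PowerSeries.coeff k L‖ < 1 := by
      have h := (hcert.trans_lt hp1)
      calc ‖PowerSeries.coeff k L‖ = ‖(PowerSeries.coeff k L - _) + _‖ := by rw [sub_add_cancel]
        _ ≤ max ‖PowerSeries.coeff k L - _‖ ‖_‖ := Padic.nonarchimedean _ _
        _ < 1 := max_lt h hRS
    exact absurd hk (not_le.mpr hlt)

/-- **The μ-claim at the pair gives the orbit-unit carrier at the pair** (converse of S3 in the carriers' currency, for one
newform): under Mazur's Manin-constant fact (`‖ϖ‖_p = 1`), a unit coefficient of `ϖ·L` for the Mazur–Tate–Teitelbaum function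
`L` with the allowable root gives a Teichmüller orbit sum of norm `≥ 1` at some level `n ≥ 1`.
[cite: MazurTateTeitelbaum1986Invent, §I.10 (10.1), §I.12–I.13] [cite: Mazur1978, Cor. 4.1] -/
theorem exists_one_le_norm_teichOrbitSum_of_norm_coeff_periodRatio_mul_eq_one
    (hMz : mazur_not_dvd_maninConstant_of_odd) (hp2 : p ≠ 2)
    (hmult : W.HasMultiplicativeReductionAtPrime p) (hirr : W.HasIrreducibleModPGaloisRep p) (hf : IsNewformOf W f)
    {ϖ : ℚ} (hϖ : (ϖ : ℝ) * W.realPeriodRat = plusPeriod f)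
    {a : ℚ_[p]} {L : PowerSeries ℚ_[p]}
    (hsa : W.HasSplitMultiplicativeReductionAtPrime p → a = 1)
    (hna : ¬ W.HasSplitMultiplicativeReductionAtPrime p → a = -1)
    (hL : IsMultPAdicLFunctionOf f p a L) {k : ℕ}
    (hk : ‖PowerSeries.coeff k (PowerSeries.C ((ϖ : ℚ) : ℚ_[p]) * L)‖ = 1) :
    ∃ n : ℕ, 1 ≤ n ∧ ∃ u : (ZMod (p ^ n))ˣ, 1 ≤ ‖((teichOrbitSum f p n (u : ZMod (p ^ n)) : ℚ) : ℚ_[p])‖ := by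
  have hϖ1 : ‖((ϖ : ℚ) : ℚ_[p])‖ = 1 :=
    X11b.ClassClosure.norm_ratCast_periodRatio_eq_one_of_mazur W p hMz hp2 hmult hirr hf hϖ
  rw [PowerSeries.coeff_C_mul, norm_mul, hϖ1, one_mul] at hk
  exact exists_one_le_norm_teichOrbitSum_of_one_le_norm_coeff hp2 hmult hirr hf hsa hna hL hk.ge

end Converse

end Summit.BirchSwinnertonDyer.BirchSwinnertonDyer.Cruxes.UpperNonSurjFive.MultTeich

end
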